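import Summits.QuantumFields.QCD.Theses.PauliWegnerSea
import Literature.MathematicalPhysics.QuantumLattice.OverlapLocality
import Literature.MathematicalPhysics.QuantumLattice.WilsonPropagatorHeavyMass
import Summits.QuantumFields.QCD.Theorems.PauliWegnerSeaFibreCofactorDominationStubHeavyMass
import Summits.QuantumFields.QCD.Theorems.PauliWegnerSeaFibreCofactorDominationStubWindow
import Summits.QuantumFields.QCD.Theorems.PauliWegnerSeaFibreCofactorDominationStubMaximiser
import Summits.QuantumFields.QCD.Theorems.PauliWegnerSeaFibreCofactorDominationStubNikolskii

/-!
# Crux `FibreCofactorDomination` (stmt-QuantumFields-11510) — line `Sketch-ideator3`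
(card A `random-refit-second-moment`), lead's concluding skeleton.

STATUS (lead prover-line-stmt-QuantumFields-11510-0, 2026-08-16): every stub of the composition is
CLOSED (landed and aliased below: `stub_window` p86336, `stub_heavyMass` p86135, `stub_nikolskii`
p89625, `stub_maximiser` p86361) except `stub_meanSquare` (C⁺, card A's transfer), which is
crux-sized — indeed EQUIVALENT to the crux on `m₀ ∈ [−2,0]`: `⇐` is this composition, `⇒` is the
landed `Summit.QuantumFields.QCD.Theorems.RandomRefit.stub_cplus_of_crux` (p90796, file
`Theorems/PauliWegnerSeaFibreCofactorDominationStubCplusOfCrux.lean`, with the companion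
`stub_detNikolskii`, two-star Nikolskii for `det`).  Further landed support of this line:
`…RandomRefit.stub_polyModel` (p89615, band limit of the adjugate block as an `MvPolynomial` of
total degree ≤ 216 in the star links), `…RandomRefit.stub_nikolskii_oneLink` / `NikolskiiPrep`
(p89121), and the generic Literature tools `Literature.Analysis.Approximation.nikolskii_finite_family`
/ `nikolskii_mvPolynomial` (p87600), `Literature.MeasureTheory.Integral.integral_comp_embedding_pi`
(p88260), `Literature.LinearAlgebra.Matrix.totalDegree_adjugate_le` (p88756),
`Literature.LinearAlgebra.Matrix.adjugate_fromBlocks_inl_inl` (p90003, port compression).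
Census of the residual: `Cruxes/FibreCofactorDomination/NOTES-lead-census.md`.

Composition: split the bare mass.
* `0 < m₀ ≤ 2` (heavy): pointwise `m₀‖adj D_{pq}‖ ≤ ‖det D‖` (`stub_heavyMass`), `W' := W`.
* `−2 ≤ m₀ ≤ 0` (light): window saturation `n_w = 12L⁴` at `θ₀ = 11` (`stub_window`, CLOSED);
  two-star Nikolskii for the adjugate block (`stub_nikolskii`); the transferred crux C⁺ =
  mean-square cofactor domination under product Haar (`stub_meanSquare`); and a fibre maximiser
  of `|det|²` above its Haar mean (`stub_maximiser`).
-/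

namespace Summit.QuantumFields.QCD.Cruxes.FibreCofactorDomination.SketchIdeator3

open scoped BigOperators Matrix
open MeasureTheory Filter Literature.MathematicalPhysics.QuantumFieldTheory
  Literature.MathematicalPhysics.QuantumLattice Literature.Probability.LatticeModels

/-- CLOSED STUB (window saturation; landed p86336 as
`Summit.QuantumFields.QCD.Theorems.RandomRefit.stub_window`). At `θ₀ = 11 > ‖γ₅ D_W‖` every
characteristic root of `γ₅ D_W(U)` lies in the window, so the in-window count is `12 L⁴`. -/
theorem stub_window : ∀ (m₀ : ℝ), -2 ≤ m₀ → m₀ ≤ 2 → ∀ (L : ℕ) [NeZero L]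
    (U : GaugeConfig 4 L (Matrix.specialUnitaryGroup (Fin 3) ℂ)),
    Multiset.countP (fun z : ℂ => |z.re| < 11)
        (spinorLift gammaFive * wilsonDirac (fundamentalRep (Fin 3)) U m₀ 1).charpoly.roots =
      Fintype.card (TorusSite 4 L × Fin 3 × Fin 4) :=
  Summit.QuantumFields.QCD.Theorems.RandomRefit.stub_window

/-- CLOSED STUB (heavy mass, pointwise; landed p86135 as
`Summit.QuantumFields.QCD.Theorems.RandomRefit.stub_heavyMass`). For `m₀ > 0` every adjugate
entry of the `r = 1` Wilson–Dirac matrix is at most `|det| / m₀`. -/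
theorem stub_heavyMass : ∀ (L : ℕ) [NeZero L]
    (U : GaugeConfig 4 L (Matrix.specialUnitaryGroup (Fin 3) ℂ)) (m₀ : ℝ), 0 < m₀ →
    ∀ p q : TorusSite 4 L × Fin 3 × Fin 4,
      m₀ * ‖(wilsonDirac (fundamentalRep (Fin 3)) U m₀ 1).adjugate p q‖ ≤
        ‖(wilsonDirac (fundamentalRep (Fin 3)) U m₀ 1).det‖ :=
  Summit.QuantumFields.QCD.Theorems.RandomRefit.stub_heavyMass

/-- CLOSED STUB (two-star Nikolskii for the adjugate block; landed p89625 as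
`Summit.QuantumFields.QCD.Theorems.RandomRefit.stub_nikolskii` — one-link cofactor polynomial
structure + finite-family Nikolskii + peeling the ≤ 16 star links). Sup over the fibre of the sum
of squared moduli of the `(x,y)` adjugate block is at most an absolute constant times its
product-Haar mean. -/
theorem stub_nikolskii : ∃ CN : ℝ, 0 < CN ∧ ∀ (m₀ : ℝ), -2 ≤ m₀ → m₀ ≤ 2 → ∀ (L : ℕ) [NeZero L],
    4 ≤ L → ∀ (U : GaugeConfig 4 L (Matrix.specialUnitaryGroup (Fin 3) ℂ)) (x y : TorusSite 4 L)
    (W₀ : GaugeConfig 4 L (Matrix.specialUnitaryGroup (Fin 3) ℂ)),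
    (∑ a : Fin 3, ∑ i : Fin 4, ∑ b : Fin 3, ∑ j : Fin 4,
        ‖(wilsonDirac (fundamentalRep (Fin 3)) (fun e => if e.1 = x ∨ Site.shift e.1 e.2 = x ∨ e.1 = y ∨ Site.shift e.1 e.2 = y then W₀ e else U e) m₀ 1).adjugate (x, a, i) (y, b, j)‖ ^ 2) ≤
      CN * ∫ W, (∑ a : Fin 3, ∑ i : Fin 4, ∑ b : Fin 3, ∑ j : Fin 4,
        ‖(wilsonDirac (fundamentalRep (Fin 3)) (fun e => if e.1 = x ∨ Site.shift e.1 e.2 = x ∨ e.1 = y ∨ Site.shift e.1 e.2 = y then W e else U e) m₀ 1).adjugate (x, a, i) (y, b, j)‖ ^ 2)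
        ∂(Measure.pi fun _ : Edge 4 L => haarProbability (Matrix.specialUnitaryGroup (Fin 3) ℂ)) :=
  Summit.QuantumFields.QCD.Theorems.RandomRefit.stub_nikolskii

/-- STUB (C⁺ = mean-square cofactor domination — card A's transfer of the crux, light masses; the
constant may depend on the bare mass, exactly as `C₀` does in the crux).  Under product Haar on
the links (equivalently on the two-star fibre, `refit` ignores the other links) the second moment
of the `x–y` adjugate block is at most `C(m₀) (1 + 12L⁴)² ×` the second moment of `det` — the
`N_f = 2`, `β = 0` sea on the fibre with frozen exterior.  EQUIVALENT to the crux restricted to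
`m₀ ∈ [−2,0]` (`stub_cplus_of_crux` gives the converse). -/
theorem stub_meanSquare : ∀ (m₀ : ℝ), -2 ≤ m₀ → m₀ ≤ 0 → ∃ C : ℝ, 0 < C ∧ ∀ (L : ℕ) [NeZero L],
    4 ≤ L → ∀ (U : GaugeConfig 4 L (Matrix.specialUnitaryGroup (Fin 3) ℂ)) (x y : TorusSite 4 L),
    x ≠ y →
    ∫ W, (∑ a : Fin 3, ∑ i : Fin 4, ∑ b : Fin 3, ∑ j : Fin 4,
        ‖(wilsonDirac (fundamentalRep (Fin 3)) (fun e => if e.1 = x ∨ Site.shift e.1 e.2 = x ∨ e.1 = y ∨ Site.shift e.1 e.2 = y then W e else U e) m₀ 1).adjugate (x, a, i) (y, b, j)‖ ^ 2)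
        ∂(Measure.pi fun _ : Edge 4 L => haarProbability (Matrix.specialUnitaryGroup (Fin 3) ℂ)) ≤
      C * (1 + (Fintype.card (TorusSite 4 L × Fin 3 × Fin 4) : ℝ)) ^ 2 *
        ∫ W, ‖(wilsonDirac (fundamentalRep (Fin 3)) (fun e => if e.1 = x ∨ Site.shift e.1 e.2 = x ∨ e.1 = y ∨ Site.shift e.1 e.2 = y then W e else U e) m₀ 1).det‖ ^ 2
          ∂(Measure.pi fun _ : Edge 4 L => haarProbability (Matrix.specialUnitaryGroup (Fin 3) ℂ)) := by
  sorry

/-- CLOSED STUB (fibre maximiser of `|det|²` above its Haar mean; landed p86361 as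
`Summit.QuantumFields.QCD.Theorems.RandomRefit.stub_maximiser`). -/
theorem stub_maximiser : ∀ (m₀ : ℝ) (L : ℕ) [NeZero L]
    (U : GaugeConfig 4 L (Matrix.specialUnitaryGroup (Fin 3) ℂ)) (x y : TorusSite 4 L),
    ∃ W' : GaugeConfig 4 L (Matrix.specialUnitaryGroup (Fin 3) ℂ),
      ∫ W, ‖(wilsonDirac (fundamentalRep (Fin 3)) (fun e => if e.1 = x ∨ Site.shift e.1 e.2 = x ∨ e.1 = y ∨ Site.shift e.1 e.2 = y then W e else U e) m₀ 1).det‖ ^ 2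
          ∂(Measure.pi fun _ : Edge 4 L => haarProbability (Matrix.specialUnitaryGroup (Fin 3) ℂ)) ≤
        ‖(wilsonDirac (fundamentalRep (Fin 3)) (fun e => if e.1 = x ∨ Site.shift e.1 e.2 = x ∨ e.1 = y ∨ Site.shift e.1 e.2 = y then W' e else U e) m₀ 1).det‖ ^ 2 :=
  Summit.QuantumFields.QCD.Theorems.RandomRefit.stub_maximiser

/-- Cauchy–Schwarz bookkeeping: `(Σ_k u_k)² ≤ 144 Σ_k u_k²` over the `3·4·3·4 = 144` block
indices. -/
theorem sum_sq_le_card_mul (u : Fin 3 → Fin 4 → Fin 3 → Fin 4 → ℝ) :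
    (∑ a, ∑ i, ∑ b, ∑ j, u a i b j) ^ 2 ≤ 144 * ∑ a, ∑ i, ∑ b, ∑ j, (u a i b j) ^ 2 := by
  have key : ∀ (s : Finset (Fin 3 × Fin 4 × Fin 3 × Fin 4)) (f : Fin 3 × Fin 4 × Fin 3 × Fin 4 → ℝ),
      (∑ k ∈ s, f k) ^ 2 ≤ s.card * ∑ k ∈ s, f k ^ 2 := fun s f =>
    sq_sum_le_card_mul_sum_sq
  have h := key Finset.univ (fun k => u k.1 k.2.1 k.2.2.1 k.2.2.2)
  simp only [Finset.card_univ, Fintype.card_prod, Fintype.card_fin] at h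
  simp only [Fintype.sum_prod_type] at h
  norm_num at h
  exact h

/-- Heavy-mass bookkeeping: entrywise `m·u ≤ d` over the 144 block indices gives
`Σ u ≤ (144/m)(1+n) d` for any `n ≥ 0`. -/
theorem heavy_chain (u : Fin 3 → Fin 4 → Fin 3 → Fin 4 → ℝ) (d m n : ℝ) (hm : 0 < m)
    (hn : 0 ≤ n) (hd : 0 ≤ d) (h : ∀ a i b j, m * u a i b j ≤ d) :
    (∑ a, ∑ i, ∑ b, ∑ j, u a i b j) ≤ 144 / m * (1 + n) * d := by
  have hentry : ∀ a i b j, u a i b j ≤ d / m := fun a i b j => by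
    rw [le_div_iff₀ hm, mul_comm]; exact h a i b j
  calc (∑ a, ∑ i, ∑ b, ∑ j, u a i b j)
      ≤ ∑ _a : Fin 3, ∑ _i : Fin 4, ∑ _b : Fin 3, ∑ _j : Fin 4, d / m := by
        gcongr with a _ i _ b _ j _
        exact hentry a i b j
    _ = 144 / m * d := by
        simp only [Finset.sum_const, Finset.card_univ, Fintype.card_fin]
        ring
    _ ≤ 144 / m * (1 + n) * d := by
        have h144 : (0 : ℝ) ≤ 144 / m := by positivity
        nlinarith [mul_nonneg (mul_nonneg h144 hn) hd]

/-- Light-mass bookkeeping: Cauchy–Schwarz, Nikolskii, C⁺ and the maximiser chain to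
`A ≤ 12 √(C_N C) (1 + card) |det(refit W′)|`. -/
theorem light_chain (A Q IQ ID dW CN C card : ℝ) (hA0 : 0 ≤ A) (hCN : 0 < CN) (hC : 0 < C)
    (hcard : 0 ≤ card) (hdW : 0 ≤ dW) (h1 : A ^ 2 ≤ 144 * Q) (h2 : Q ≤ CN * IQ)
    (h3 : IQ ≤ C * (1 + card) ^ 2 * ID) (h4 : ID ≤ dW ^ 2) :
    A ≤ 12 * Real.sqrt (CN * C) * (1 + card) * dW := by
  have hs : Real.sqrt (CN * C) ^ 2 = CN * C := Real.sq_sqrt (by positivity)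
  have hsq : A ^ 2 ≤ (12 * Real.sqrt (CN * C) * (1 + card) * dW) ^ 2 := by
    calc A ^ 2 ≤ 144 * Q := h1
      _ ≤ 144 * (CN * IQ) := by gcongr
      _ ≤ 144 * (CN * (C * (1 + card) ^ 2 * ID)) := by gcongr
      _ ≤ 144 * (CN * (C * (1 + card) ^ 2 * dW ^ 2)) := by gcongr
      _ = (12 * Real.sqrt (CN * C) * (1 + card) * dW) ^ 2 := by
        rw [mul_pow, mul_pow, mul_pow, hs]; ring
  have hR0 : 0 ≤ 12 * Real.sqrt (CN * C) * (1 + card) * dW := by positivity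
  exact (pow_le_pow_iff_left₀ hA0 hR0 two_ne_zero).1 hsq

/-- COMPOSITION: the five stubs imply the crux `PauliWegnerSea.FibreCofactorDomination`
(by name): heavy masses pointwise with `W' := W`; light masses by Cauchy–Schwarz, Nikolskii, C⁺,
the maximiser, and window saturation at `θ₀ := 11`. -/
theorem FibreCofactorDomination_of
    (hwin : ∀ (m₀ : ℝ), -2 ≤ m₀ → m₀ ≤ 2 → ∀ (L : ℕ) [NeZero L]
      (U : GaugeConfig 4 L (Matrix.specialUnitaryGroup (Fin 3) ℂ)),
      Multiset.countP (fun z : ℂ => |z.re| < 11)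
          (spinorLift gammaFive * wilsonDirac (fundamentalRep (Fin 3)) U m₀ 1).charpoly.roots =
        Fintype.card (TorusSite 4 L × Fin 3 × Fin 4))
    (hheavy : ∀ (L : ℕ) [NeZero L]
      (U : GaugeConfig 4 L (Matrix.specialUnitaryGroup (Fin 3) ℂ)) (m₀ : ℝ), 0 < m₀ →
      ∀ p q : TorusSite 4 L × Fin 3 × Fin 4,
        m₀ * ‖(wilsonDirac (fundamentalRep (Fin 3)) U m₀ 1).adjugate p q‖ ≤
          ‖(wilsonDirac (fundamentalRep (Fin 3)) U m₀ 1).det‖)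
    (hnik : ∃ CN : ℝ, 0 < CN ∧ ∀ (m₀ : ℝ), -2 ≤ m₀ → m₀ ≤ 2 → ∀ (L : ℕ) [NeZero L],
      4 ≤ L → ∀ (U : GaugeConfig 4 L (Matrix.specialUnitaryGroup (Fin 3) ℂ)) (x y : TorusSite 4 L)
      (W₀ : GaugeConfig 4 L (Matrix.specialUnitaryGroup (Fin 3) ℂ)),
      (∑ a : Fin 3, ∑ i : Fin 4, ∑ b : Fin 3, ∑ j : Fin 4,
          ‖(wilsonDirac (fundamentalRep (Fin 3)) (fun e => if e.1 = x ∨ Site.shift e.1 e.2 = x ∨ e.1 = y ∨ Site.shift e.1 e.2 = y then W₀ e else U e) m₀ 1).adjugate (x, a, i) (y, b, j)‖ ^ 2) ≤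
        CN * ∫ W, (∑ a : Fin 3, ∑ i : Fin 4, ∑ b : Fin 3, ∑ j : Fin 4,
          ‖(wilsonDirac (fundamentalRep (Fin 3)) (fun e => if e.1 = x ∨ Site.shift e.1 e.2 = x ∨ e.1 = y ∨ Site.shift e.1 e.2 = y then W e else U e) m₀ 1).adjugate (x, a, i) (y, b, j)‖ ^ 2)
          ∂(Measure.pi fun _ : Edge 4 L => haarProbability (Matrix.specialUnitaryGroup (Fin 3) ℂ)))
    (hms : ∀ (m₀ : ℝ), -2 ≤ m₀ → m₀ ≤ 0 → ∃ C : ℝ, 0 < C ∧ ∀ (L : ℕ) [NeZero L],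
      4 ≤ L → ∀ (U : GaugeConfig 4 L (Matrix.specialUnitaryGroup (Fin 3) ℂ)) (x y : TorusSite 4 L),
      x ≠ y →
      ∫ W, (∑ a : Fin 3, ∑ i : Fin 4, ∑ b : Fin 3, ∑ j : Fin 4,
          ‖(wilsonDirac (fundamentalRep (Fin 3)) (fun e => if e.1 = x ∨ Site.shift e.1 e.2 = x ∨ e.1 = y ∨ Site.shift e.1 e.2 = y then W e else U e) m₀ 1).adjugate (x, a, i) (y, b, j)‖ ^ 2)
          ∂(Measure.pi fun _ : Edge 4 L => haarProbability (Matrix.specialUnitaryGroup (Fin 3) ℂ)) ≤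
        C * (1 + (Fintype.card (TorusSite 4 L × Fin 3 × Fin 4) : ℝ)) ^ 2 *
          ∫ W, ‖(wilsonDirac (fundamentalRep (Fin 3)) (fun e => if e.1 = x ∨ Site.shift e.1 e.2 = x ∨ e.1 = y ∨ Site.shift e.1 e.2 = y then W e else U e) m₀ 1).det‖ ^ 2
            ∂(Measure.pi fun _ : Edge 4 L => haarProbability (Matrix.specialUnitaryGroup (Fin 3) ℂ)))
    (hmax : ∀ (m₀ : ℝ) (L : ℕ) [NeZero L]
      (U : GaugeConfig 4 L (Matrix.specialUnitaryGroup (Fin 3) ℂ)) (x y : TorusSite 4 L),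
      ∃ W' : GaugeConfig 4 L (Matrix.specialUnitaryGroup (Fin 3) ℂ),
        ∫ W, ‖(wilsonDirac (fundamentalRep (Fin 3)) (fun e => if e.1 = x ∨ Site.shift e.1 e.2 = x ∨ e.1 = y ∨ Site.shift e.1 e.2 = y then W e else U e) m₀ 1).det‖ ^ 2
            ∂(Measure.pi fun _ : Edge 4 L => haarProbability (Matrix.specialUnitaryGroup (Fin 3) ℂ)) ≤
          ‖(wilsonDirac (fundamentalRep (Fin 3)) (fun e => if e.1 = x ∨ Site.shift e.1 e.2 = x ∨ e.1 = y ∨ Site.shift e.1 e.2 = y then W' e else U e) m₀ 1).det‖ ^ 2) :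
    Summit.QuantumFields.QCD.Theses.PauliWegnerSea.FibreCofactorDomination := by
  intro m₀ hm₁ hm₂
  by_cases hm : 0 < m₀
  · -- heavy masses: pointwise domination, W' := W, any window (θ₀ := 1)
    refine ⟨1, 144 / m₀, one_pos, by positivity, ?_⟩
    intro L _ hL U x y hxy
    dsimp only
    intro W
    exact ⟨W, heavy_chain (fun a i b j => ‖(wilsonDirac (fundamentalRep (Fin 3)) _ m₀ 1).adjugate
      (x, a, i) (y, b, j)‖) _ m₀ _ hm (Nat.cast_nonneg _) (norm_nonneg _)
      (fun a i b j => hheavy L _ m₀ hm (x, a, i) (y, b, j))⟩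
  · -- light masses: Nikolskii + C⁺ + maximiser, window saturated at θ₀ := 11
    push Not at hm
    obtain ⟨CN, hCN, hN⟩ := hnik
    obtain ⟨C, hC, hM⟩ := hms m₀ hm₁ hm
    refine ⟨11, 12 * Real.sqrt (CN * C), by norm_num, by positivity, ?_⟩
    intro L _ hL U x y hxy
    dsimp only
    intro W
    obtain ⟨W', hW'⟩ := hmax m₀ L U x y
    refine ⟨W', ?_⟩
    have hnw : ((Multiset.countP (fun z : ℂ => |z.re| < 11)
        (spinorLift gammaFive * wilsonDirac (fundamentalRep (Fin 3)) U m₀ 1).charpoly.roots : ℕ) : ℝ)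
        = (Fintype.card (TorusSite 4 L × Fin 3 × Fin 4) : ℝ) := by
      exact_mod_cast hwin m₀ hm₁ hm₂ L U
    rw [hnw]
    exact light_chain _ _ _ _ _ CN C _ (by positivity) hCN hC (Nat.cast_nonneg _) (norm_nonneg _)
      (sum_sq_le_card_mul fun a i b j => ‖(wilsonDirac (fundamentalRep (Fin 3)) _ m₀ 1).adjugate
        (x, a, i) (y, b, j)‖) (hN m₀ hm₁ hm₂ L hL U x y W) (hM L hL U x y hxy) hW'

/-- The crux, from the stubs. -/
theorem FibreCofactorDomination_holds :
    Summit.QuantumFields.QCD.Theses.PauliWegnerSea.FibreCofactorDomination :=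
  FibreCofactorDomination_of stub_window stub_heavyMass stub_nikolskii stub_meanSquare stub_maximiser

end Summit.QuantumFields.QCD.Cruxes.FibreCofactorDomination.SketchIdeator3
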